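/-
Origin: expansion seat `planner-pub-hodgecm-pv05-g7-0`, handover #4 2026-08-18T13:38:51Z (`HOME/pub-hodgecm-pv05-g7/lean/Pv05g7/FockOneParameter.lean`, md5 0383203f, 258 lines);
landed by the gen-8 packager in gate run 30 as `HodgeCM/PerL34/FockOneParameter.lean` (import ^import Pv05g7\.FockInfinitesimalAction[ \t]*$→import HodgeCM.PerL34.FockInfinitesimalAction ×1).
-/
/-
pub-hodgecm · DAG-NODE PROVER #05 gen 7 (unit pub-hodgecm-pv05-g7) · RUN 30 candidate #4.
Target tree path: `HodgeCM/PerL34/FockOneParameter.lean` (NEW, additive leaf; nothing imports it).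
PACKAGER: rewrite `import Pv05g7.FockInfinitesimalAction` ↦ `import HodgeCM.PerL34.FockInfinitesimalAction` (ONE
`^import Pv05g7\.` rewrite); the Mathlib imports are prebuilt (`MatrixExponential`/`Exponential` already used by
`BallCRExp`).  Lands AFTER
#1 (`FockInfinitesimalAction`).  Asserts nothing: no `def … : Prop` hypothesis, no structure field posited, no
cited fact; every statement below is kernel-proved from Mathlib + the Fock lane.
-/
import Mathlib.Analysis.Normed.Algebra.MatrixExponential
import Mathlib.Analysis.SpecialFunctions.Exponential
import Mathlib.Analysis.Calculus.Deriv.Shift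
import Summits.HodgeConjecture.HodgeCM.PerL34.FockInfinitesimalAction_2

/-!
# One-parameter unitary groups `e^{tX}` (`X ∈ 𝔲(σ)`) in the Fock representation, and `Ad`-equivariance of `dΓ`

[Fo89] = Folland, *Harmonic analysis in phase space* (1989), cited by page/line of the held text.

`FockInfinitesimalAction` (#1) computed `d/dt ν₀(γ t)(F e^{−(π/2)|z|²}) = (dΓ(X)F) e^{−(π/2)|z|²}` for ANY
entrywise-differentiable path `γ` in `U(σ)` through `1` with velocity `X`, but did not produce such a path for a
given `X`.  This file supplies the canonical ones and closes the loop: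

1. (`§1`) the chain rule for linear substitutions, `∂_m (F ∘ B) = Σ_i B_{im} (∂_i F) ∘ B` (`pderiv_linSubst`), and
   the **`Ad`-equivariance of the generator**: `B X' = X B ⟹ (dΓ(X)F) ∘ B = dΓ(X')(F ∘ B)` (`linSubst_dGamma`);
   in the Fock space, **`ν₀(U) (dΓ(X)F) = dΓ(U X U⁻¹) (ν₀(U) F)`** on polynomial vectors
   (`fockRep_fockToL2_dGamma`) — the derived action is the differential of a representation;
2. (`§2`) for `Xᴴ = −X`: `e^{X} ∈ U(σ)` (`exp_mem_unitaryGroup`), the one-parameter subgroup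
   `expUnitary X hX : ℝ → U(σ)`, `t ↦ e^{tX}` (`_zero`, `_add`), and its ENTRYWISE derivative
   `d/dt (e^{tX})_{jk} = (e^{tX} X)_{jk}` (`hasDerivAt_expUnitary_entry`; Mathlib's `hasDerivAt_exp_smul_const`
   under the `L^∞`-operator norm, made entrywise exactly as in `BallCRExp`);
3. (`§3`) **`d/dt ν₀(e^{tX})(F e^{−(π/2)|z|²}) = ν₀(e^{tX}) (dΓ(X)F) e^{−(π/2)|z|²} = (dΓ(X)(F ∘ e^{−tX})) e^{−(π/2)|z|²}`**
   at EVERY `t` (`hasDerivAt_fockRep_expUnitary`, `…'`; at `t = 0` the derivative is `dΓ(X)F`): on each polynomial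
   vector the orbit `t ↦ ν₀(e^{tX})v` solves `u' = dΓ(X) u` — the differential equation of `e^{t dΓ(X)}` on the
   (invariant, finite-dimensional) `𝓟_k`'s [Fo89 Prop. 4.42, p0182 L31–37].

Honest label: polynomial core only; no Stone-generator / essential skew-adjointness statement on all of `𝓕`.
-/

noncomputable section

open MeasureTheory Complex MvPolynomial Matrix NormedSpace
open scoped Real ComplexConjugate InnerProductSpace

namespace HodgeCM.PerL34.Fock.Hermite

variable {σ : Type*} [Fintype σ] [DecidableEq σ]

/-! ## 1. Chain rule for linear substitutions and `Ad`-equivariance of `dΓ` -/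

omit [DecidableEq σ] in
/-- `∂_m (Σ_k B_{nk} z_k) = B_{nm}`. -/
theorem pderiv_linForm (B : Matrix σ σ ℂ) (n m : σ) : pderiv m (linForm B n) = C (B n m) := by
  rw [linForm, map_sum, Finset.sum_eq_single m]
  · rw [Derivation.leibniz, pderiv_C, smul_zero, add_zero, pderiv_X_self, smul_eq_mul, mul_one]
  · intro k _ hk
    rw [Derivation.leibniz, pderiv_C, smul_zero, add_zero, pderiv_X_of_ne hk, smul_zero]
  · intro h; exact absurd (Finset.mem_univ m) h

/-- **Chain rule**: `∂_m (F ∘ B) = Σ_i B_{im} · (∂_i F) ∘ B` (`(Bz)_i = Σ_k B_{ik} z_k`). -/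
theorem pderiv_linSubst (B : Matrix σ σ ℂ) (m : σ) (F : MvPolynomial σ ℂ) :
    pderiv m (linSubst B F) = ∑ i, B i m • linSubst B (pderiv i F) := by
  induction F using MvPolynomial.induction_on with
  | C a =>
    rw [linSubst_C, pderiv_C]
    simp only [pderiv_C, map_zero, smul_zero, Finset.sum_const_zero]
  | add p q hp hq =>
    rw [map_add, map_add, hp, hq, ← Finset.sum_add_distrib]
    exact Finset.sum_congr rfl fun i _ => by rw [map_add, map_add, smul_add]
  | mul_X p n hp =>
    rw [map_mul, linSubst_X_eq_linForm, Derivation.leibniz, smul_eq_mul, smul_eq_mul, hp, pderiv_linForm]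
    have hr : ∀ i, B i m • linSubst B (pderiv i (p * X n))
        = B i m • (linForm B n * linSubst B (pderiv i p)) + (if n = i then B i m • linSubst B p else 0) := by
      intro i
      rw [Derivation.leibniz, smul_eq_mul, smul_eq_mul, pderiv_X, Pi.single_apply, map_add, map_mul, map_mul,
        linSubst_X_eq_linForm, smul_add, add_comm]
      congr 1
      split_ifs
      · rw [map_one, mul_one]
      · rw [map_zero, mul_zero, smul_zero]
    simp_rw [hr]
    rw [Finset.sum_add_distrib, Finset.sum_ite_eq Finset.univ n, if_pos (Finset.mem_univ n), add_comm,
      Finset.mul_sum, smul_eq_C_mul, mul_comm (C (B n m)) (linSubst B p)]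
    congr 1
    exact Finset.sum_congr rfl fun i _ => mul_smul_comm _ _ _

/-- **`Ad`-equivariance of `dΓ` at the polynomial level**: if `B X' = X B` then `(dΓ(X) F) ∘ B = dΓ(X') (F ∘ B)`
(for invertible `B`: `X' = B⁻¹ X B`). -/
theorem linSubst_dGamma {B X X' : Matrix σ σ ℂ} (h : B * X' = X * B) (F : MvPolynomial σ ℂ) :
    linSubst B (dGamma X F) = dGamma X' (linSubst B F) := by
  rw [dGamma_apply, dGamma_apply, map_neg]
  congr 1
  -- left: Σ_j Σ_k X_{jk} (Bz)_k (∂_j F)∘B ;  right: Σ_j Σ_k X'_{jk} z_k Σ_i B_{ij} (∂_i F)∘B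
  have hL : linSubst B (∑ j, ∑ k, X j k • (MvPolynomial.X k * pderiv j F))
      = ∑ i, ∑ k, (∑ l, X i l * B l k) • (MvPolynomial.X k * linSubst B (pderiv i F)) := by
    rw [map_sum]
    refine Finset.sum_congr rfl fun i _ => ?_
    rw [map_sum]
    simp_rw [map_smul, map_mul, linSubst_X_eq_linForm, linForm, Finset.sum_mul, Finset.smul_sum]
    rw [Finset.sum_comm]
    refine Finset.sum_congr rfl fun k _ => ?_
    rw [Finset.sum_smul]
    exact Finset.sum_congr rfl fun l _ => by rw [smul_eq_C_mul, smul_eq_C_mul, map_mul]; ring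
  have hR : ∑ j, ∑ k, X' j k • (MvPolynomial.X k * pderiv j (linSubst B F))
      = ∑ i, ∑ k, (∑ j, B i j * X' j k) • (MvPolynomial.X k * linSubst B (pderiv i F)) := by
    calc ∑ j, ∑ k, X' j k • (MvPolynomial.X k * pderiv j (linSubst B F))
        = ∑ j, ∑ k, ∑ i, (B i j * X' j k) • (MvPolynomial.X k * linSubst B (pderiv i F)) := by
          refine Finset.sum_congr rfl fun j _ => Finset.sum_congr rfl fun k _ => ?_
          rw [pderiv_linSubst, Finset.mul_sum, Finset.smul_sum]
          exact Finset.sum_congr rfl fun i _ => by rw [mul_smul_comm, smul_smul, mul_comm (B i j)]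
      _ = ∑ j, ∑ i, ∑ k, (B i j * X' j k) • (MvPolynomial.X k * linSubst B (pderiv i F)) :=
          Finset.sum_congr rfl fun j _ => Finset.sum_comm
      _ = ∑ i, ∑ j, ∑ k, (B i j * X' j k) • (MvPolynomial.X k * linSubst B (pderiv i F)) := Finset.sum_comm
      _ = ∑ i, ∑ k, ∑ j, (B i j * X' j k) • (MvPolynomial.X k * linSubst B (pderiv i F)) :=
          Finset.sum_congr rfl fun i _ => Finset.sum_comm
      _ = ∑ i, ∑ k, (∑ j, B i j * X' j k) • (MvPolynomial.X k * linSubst B (pderiv i F)) :=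
          Finset.sum_congr rfl fun i _ => Finset.sum_congr rfl fun k _ => (Finset.sum_smul).symm
  rw [hL, hR]
  refine Finset.sum_congr rfl fun i _ => Finset.sum_congr rfl fun k _ => ?_
  rw [← Matrix.mul_apply, ← Matrix.mul_apply, h]

/-- **`ν₀(U) dΓ(X) = dΓ(Ad_U X) ν₀(U)` on polynomial vectors** (`Ad_U X = U X U⁻¹ = U X Uᴴ`):
the derived action is `Ad`-equivariant under the genuine unitary action [Fo89 Prop (4.39)/(4.42)]. -/
theorem fockRep_fockToL2_dGamma (U : Matrix.unitaryGroup σ ℂ) (X : Matrix σ σ ℂ) (F : MvPolynomial σ ℂ) :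
    fockRep U (fockToL2 (dGamma X F))
      = fockToL2 (dGamma ((U : Matrix σ σ ℂ) * X * star (U : Matrix σ σ ℂ))
          (linSubst (star (U : Matrix σ σ ℂ)) F)) := by
  have hU : star (U : Matrix σ σ ℂ) * ((U : Matrix σ σ ℂ) * X * star (U : Matrix σ σ ℂ))
      = X * star (U : Matrix σ σ ℂ) := by
    rw [← Matrix.mul_assoc, ← Matrix.mul_assoc, Matrix.UnitaryGroup.star_mul_self, Matrix.one_mul]
  rw [fockRep_fockToL2, linSubst_dGamma hU]

/-- The same with `ν₀(U)F` on the right written as a Fock vector: `ν₀(U)(dΓ(X)F) = dΓ(U X Uᴴ)(F ∘ Uᴴ)` and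
`F ∘ Uᴴ` is the polynomial of `ν₀(U)F`. -/
theorem fockRep_fockToL2_dGamma' (U : Matrix.unitaryGroup σ ℂ) (X : Matrix σ σ ℂ) (F : MvPolynomial σ ℂ) :
    fockRep U (fockToL2 (dGamma (star (U : Matrix σ σ ℂ) * X * (U : Matrix σ σ ℂ)) F))
      = fockToL2 (dGamma X (linSubst (star (U : Matrix σ σ ℂ)) F)) := by
  rw [fockRep_fockToL2_dGamma, ← Matrix.mul_assoc, ← Matrix.mul_assoc, Unitary.mul_star_self_of_mem U.2,
    Matrix.one_mul, Matrix.mul_assoc, Unitary.mul_star_self_of_mem U.2, Matrix.mul_one]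

/-! ## 2. The one-parameter unitary groups `t ↦ e^{tX}`, `X ∈ 𝔲(σ)` -/

/-- **`e^X ∈ U(σ)` for `Xᴴ = −X`.** -/
theorem exp_mem_unitaryGroup {X : Matrix σ σ ℂ} (hX : star X = -X) : exp X ∈ Matrix.unitaryGroup σ ℂ := by
  have hXH : Xᴴ = -X := by rwa [← Matrix.star_eq_conjTranspose]
  have hexpH : (exp X)ᴴ = exp (-X) := by rw [← Matrix.exp_conjTranspose, hXH]
  refine Unitary.mem_iff.mpr ⟨?_, ?_⟩
  · rw [Matrix.star_eq_conjTranspose, hexpH, ← Matrix.exp_add_of_commute _ _ (Commute.refl X).neg_left,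
      neg_add_cancel, NormedSpace.exp_zero]
  · rw [Matrix.star_eq_conjTranspose, hexpH, ← Matrix.exp_add_of_commute _ _ (Commute.refl X).neg_right,
      add_neg_cancel, NormedSpace.exp_zero]

omit [Fintype σ] [DecidableEq σ] in
/-- (Ported verbatim from the HodgeCMPerL package; no docstring in the source.) -/
theorem star_real_smul_of_star_eq_neg {X : Matrix σ σ ℂ} (hX : star X = -X) (t : ℝ) :
    star ((t : ℂ) • X) = -((t : ℂ) • X) := by
  rw [star_smul, hX, smul_neg, Complex.star_def, Complex.conj_ofReal]

/-- **The one-parameter subgroup `t ↦ e^{tX}` of `U(σ)`** generated by `X ∈ 𝔲(σ)`. -/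
def expUnitary (X : Matrix σ σ ℂ) (hX : star X = -X) (t : ℝ) : Matrix.unitaryGroup σ ℂ :=
  ⟨exp ((t : ℂ) • X), exp_mem_unitaryGroup (star_real_smul_of_star_eq_neg hX t)⟩

/-- (Ported verbatim from the HodgeCMPerL package; no docstring in the source.) -/
@[simp] theorem coe_expUnitary {X : Matrix σ σ ℂ} (hX : star X = -X) (t : ℝ) :
    (expUnitary X hX t : Matrix σ σ ℂ) = exp ((t : ℂ) • X) := rfl

/-- (Ported verbatim from the HodgeCMPerL package; no docstring in the source.) -/
theorem expUnitary_zero {X : Matrix σ σ ℂ} (hX : star X = -X) : expUnitary X hX 0 = 1 :=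
  Subtype.ext (by rw [coe_expUnitary, Complex.ofReal_zero, zero_smul, NormedSpace.exp_zero]; rfl)

/-- `e^{(s+t)X} = e^{sX} e^{tX}`: a homomorphism `ℝ → U(σ)`. -/
theorem expUnitary_add {X : Matrix σ σ ℂ} (hX : star X = -X) (s t : ℝ) :
    expUnitary X hX (s + t) = expUnitary X hX s * expUnitary X hX t :=
  Subtype.ext (by
    change exp (((s + t : ℝ) : ℂ) • X) = exp ((s : ℂ) • X) * exp ((t : ℂ) • X)
    rw [Complex.ofReal_add, add_smul]
    exact Matrix.exp_add_of_commute _ _ ((Commute.refl X).smul_left _ |>.smul_right _))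

/-- (Ported verbatim from the HodgeCMPerL package; no docstring in the source.) -/
theorem expUnitary_neg {X : Matrix σ σ ℂ} (hX : star X = -X) (t : ℝ) :
    expUnitary X hX (-t) = (expUnitary X hX t)⁻¹ :=
  eq_inv_of_mul_eq_one_left (by rw [← expUnitary_add, neg_add_cancel, expUnitary_zero])

/-- `e^{tX}` commutes with `X`. -/
theorem expUnitary_commute {X : Matrix σ σ ℂ} (hX : star X = -X) (t : ℝ) :
    (expUnitary X hX t : Matrix σ σ ℂ) * X = X * (expUnitary X hX t : Matrix σ σ ℂ) :=
  (((Commute.refl X).smul_left (t : ℂ)).exp_left).eq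

section deriv

attribute [local instance] Matrix.linftyOpNormedRing Matrix.linftyOpNormedAlgebra

/-- Entrywise derivative of `u ↦ e^{uX}` (complex parameter): `d/du (e^{uX})_{jk} = (e^{uX} X)_{jk}`. -/
theorem hasDerivAt_matrixExp_smul_entry (X : Matrix σ σ ℂ) (u₀ : ℂ) (j k : σ) :
    HasDerivAt (fun u : ℂ => exp (u • X) j k) ((exp (u₀ • X) * X) j k) u₀ := by
  have h : HasDerivAt (fun u : ℂ => exp (u • X)) (exp (u₀ • X) * X) u₀ := hasDerivAt_exp_smul_const X u₀
  let L : Matrix σ σ ℂ →L[ℂ] ℂ := LinearMap.toContinuousLinearMap (Matrix.entryLinearMap ℂ ℂ j k)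
  exact L.hasFDerivAt.comp_hasDerivAt u₀ h

end deriv

/-- **`d/dt (e^{tX})_{jk} = (e^{tX} X)_{jk}`** (real parameter, every `t`). -/
theorem hasDerivAt_expUnitary_entry {X : Matrix σ σ ℂ} (hX : star X = -X) (t₀ : ℝ) (j k : σ) :
    HasDerivAt (fun t : ℝ => (expUnitary X hX t : Matrix σ σ ℂ) j k) ((exp ((t₀ : ℂ) • X) * X) j k) t₀ :=
  (hasDerivAt_matrixExp_smul_entry X (t₀ : ℂ) j k).comp_ofReal

/-- At `t = 0` the velocity is `X`. -/
theorem hasDerivAt_expUnitary_entry_zero {X : Matrix σ σ ℂ} (hX : star X = -X) (j k : σ) :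
    HasDerivAt (fun t : ℝ => (expUnitary X hX t : Matrix σ σ ℂ) j k) (X j k) 0 := by
  have h := hasDerivAt_expUnitary_entry hX 0 j k
  rwa [Complex.ofReal_zero, zero_smul, NormedSpace.exp_zero, Matrix.one_mul] at h

/-! ## 3. The generator along `e^{tX}` -/

/-- **`d/dt|₀ ν₀(e^{tX})(F e^{−(π/2)|z|²}) = (dΓ(X)F) e^{−(π/2)|z|²}`** for `X ∈ 𝔲(σ)` and every polynomial `F`. -/
theorem hasDerivAt_fockRep_expUnitary_zero {X : Matrix σ σ ℂ} (hX : star X = -X) (F : MvPolynomial σ ℂ) :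
    HasDerivAt (fun t : ℝ => fockRep (expUnitary X hX t) (fockToL2 F)) (fockToL2 (dGamma X F)) 0 :=
  hasDerivAt_fockRep_path_one (hasDerivAt_expUnitary_entry_zero hX) (expUnitary_zero hX) F

/-- (Ported verbatim from the HodgeCMPerL package; no docstring in the source.) -/
theorem deriv_fockRep_expUnitary_zero {X : Matrix σ σ ℂ} (hX : star X = -X) (F : MvPolynomial σ ℂ) :
    deriv (fun t : ℝ => fockRep (expUnitary X hX t) (fockToL2 F)) 0 = fockToL2 (dGamma X F) :=
  (hasDerivAt_fockRep_expUnitary_zero hX F).deriv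

/-- **At every `t`: `d/dt ν₀(e^{tX})v = ν₀(e^{tX}) (dΓ(X) v)`** on polynomial vectors `v = F e^{−(π/2)|z|²}` (the
semigroup form `u'(t) = U(t) A u₀`, from the group law `e^{tX} = e^{t₀X} e^{(t−t₀)X}`). -/
theorem hasDerivAt_fockRep_expUnitary {X : Matrix σ σ ℂ} (hX : star X = -X) (t₀ : ℝ) (F : MvPolynomial σ ℂ) :
    HasDerivAt (fun t : ℝ => fockRep (expUnitary X hX t) (fockToL2 F))
      (fockRep (expUnitary X hX t₀) (fockToL2 (dGamma X F))) t₀ := by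
  have hfun : (fun t : ℝ => fockRep (expUnitary X hX t) (fockToL2 F))
      = fun t => fockRep (expUnitary X hX t₀) (fockRep (expUnitary X hX (t - t₀)) (fockToL2 F)) := by
    funext t
    have ht : expUnitary X hX t = expUnitary X hX t₀ * expUnitary X hX (t - t₀) := by
      rw [← expUnitary_add, add_sub_cancel]
    rw [ht, map_mul, LinearIsometryEquiv.coe_mul, Function.comp_apply]
  have h0 := hasDerivAt_fockRep_expUnitary_zero hX F
  rw [← sub_self t₀] at h0
  have hin : HasDerivAt (fun t : ℝ => fockRep (expUnitary X hX (t - t₀)) (fockToL2 F)) (fockToL2 (dGamma X F))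
      t₀ := h0.comp_sub_const t₀ t₀
  let L : FockL2 σ →L[ℝ] FockL2 σ :=
    ((fockRep (expUnitary X hX t₀)).toContinuousLinearEquiv : FockL2 σ →L[ℂ] FockL2 σ).restrictScalars ℝ
  rw [hfun]
  exact L.hasFDerivAt.comp_hasDerivAt t₀ hin

/-- **… `= dΓ(X) (ν₀(e^{tX}) v)`** (the form `u'(t) = A U(t) u₀`): the polynomial of `ν₀(e^{t₀X})(F e^{−(π/2)|z|²})`
is `F ∘ e^{−t₀X}` and the derivative at `t₀` is `(dΓ(X)(F ∘ e^{−t₀X})) e^{−(π/2)|z|²}` — by `Ad`-equivariance and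
`e^{t₀X} X e^{−t₀X} = X`. -/
theorem hasDerivAt_fockRep_expUnitary' {X : Matrix σ σ ℂ} (hX : star X = -X) (t₀ : ℝ) (F : MvPolynomial σ ℂ) :
    HasDerivAt (fun t : ℝ => fockRep (expUnitary X hX t) (fockToL2 F))
      (fockToL2 (dGamma X (linSubst (star (expUnitary X hX t₀ : Matrix σ σ ℂ)) F))) t₀ := by
  have h := hasDerivAt_fockRep_expUnitary hX t₀ F
  rwa [fockRep_fockToL2_dGamma, expUnitary_commute, Matrix.mul_assoc,
    Unitary.mul_star_self_of_mem (expUnitary X hX t₀).2, Matrix.mul_one] at h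

/-- The orbit of a polynomial vector stays polynomial: `ν₀(e^{tX})(F e^{−(π/2)|z|²}) = (F ∘ e^{−tX}) e^{−(π/2)|z|²}`,
so `hasDerivAt_fockRep_expUnitary'` is literally the ODE `u'(t) = dΓ(X) u(t)` on the polynomial core. -/
theorem fockRep_expUnitary_fockToL2 {X : Matrix σ σ ℂ} (hX : star X = -X) (t : ℝ) (F : MvPolynomial σ ℂ) :
    fockRep (expUnitary X hX t) (fockToL2 F) = fockToL2 (linSubst (star (expUnitary X hX t : Matrix σ σ ℂ)) F) :=
  fockRep_fockToL2 _ F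

end HodgeCM.PerL34.Fock.Hermite

end
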